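import Literature.NumberTheory.ModularForms.ModerateGrowth
import Literature.NumberTheory.ModularForms.JacobiThetaGammaTwo
import Mathlib.NumberTheory.LSeries.HurwitzZetaValues
import HarnessLib

/-!
# `E₂` under `S` and the functions `φ₋₂, φ₀, φ₂` of CKMRV Proposition 4.2

Cohn–Kumar–Miller–Radchenko–Viazovska, Ann. of Math. 196 (2022) = arXiv:1902.05438.

* §2.1.1, (2.3)–(2.4): "the quasimodular form `E₂(z) = 1 − 24 ∑ σ₁(n) qⁿ` … just barely fails to
  be modular: `E₂(z+1) = E₂(z)` and `E₂(−1/z) = z² E₂(z) − 6iz/π`" — PROVED for Mathlib's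
  `EisensteinSeries.E2` from its transformation law `E2_slash_action` and `ζ(2) = π²/6`
  (`E2_S_smul`; periodicity is `E2_vadd_one` of `ModerateGrowth.lean`).
* §4.2, Proposition 4.2: the functions
  `φ₂(τ) = τE₂(τ)² − (6i/π)E₂(τ)`, `φ₀(τ) = τE₂(τ) − 3i/π`, `φ₋₂(τ) = τ`
  (`phi2`, `phi0`, `phiNeg2`), their behaviour under `T` and `S`
  (`φⱼ|ⱼT = φⱼ + E₂^{(2−j)/2}`, `φⱼ|ⱼS = −φⱼ`), membership in `𝓟`, and the EASY INCLUSION of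
  Proposition 4.2: for a level-one modular (i.e. `T`- and `S`-invariant) `f` of weight `k − j`,
  `φⱼ f` solves the system (4.5) `g|ₖ(T − I)² = 0`, `g|ₖ(S + I) = 0`
  (`phiNeg2_mul_mem_ann`, `phi0_mul_mem_ann`, `phi2_mul_mem_ann`) — "it is straightforward to
  verify that all elements of (4.6) satisfy the conditions in (4.5)". (The reverse inclusion,
  `Ann_k(𝓘₊, 𝓟) ⊆ φ₂M_{k−2} + φ₀M_k + φ₋₂M_{k+2}`, is the uniqueness half and is not vendored.)

## References

* H. Cohn, A. Kumar, S. D. Miller, D. Radchenko, M. Viazovska, Ann. of Math. 196 (2022),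
  arXiv:1902.05438, §2.1.1 (2.3)–(2.4); §4.2 Proposition 4.2 and (4.5)–(4.6). [CohnEtAl2019]
-/

noncomputable section

open Complex hiding I
open Filter Topology ModularForm SlashInvariantForm EisensteinSeries
open UpperHalfPlane hiding I
open Complex (I)
open scoped Real MatrixGroups ModularForm Manifold

namespace Literature.NumberTheory.ModularForms

/-! ## `E₂` under `S` -/

/-- **`E₂(−1/z) = z²E₂(z) − 6iz/π`** (CKMRV (2.4)), for Mathlib's `E₂`: from
`E₂|₂γ = E₂ − (2ζ(2))⁻¹D₂(γ)`, `D₂(S)(z) = 2πi/z` and `ζ(2) = π²/6`. [cite: CohnEtAl2019, §2.1.1 (2.4)] -/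
theorem E2_S_smul (τ : ℍ) :
    E2 (ModularGroup.S • τ) = (τ : ℂ) ^ 2 * E2 τ - 6 * I * (τ : ℂ) / π := by
  have h := congrFun (E2_slash_action ModularGroup.S) τ
  rw [SL_slash_apply, ModularGroup.denom_S, Pi.sub_apply, Pi.smul_apply, smul_eq_mul, D2_S,
    riemannZeta_two] at h
  have hτ : (τ : ℂ) ≠ 0 := τ.ne_zero
  have hπ : (π : ℂ) ≠ 0 := ofReal_ne_zero.2 Real.pi_ne_zero
  have h' : E2 (ModularGroup.S • τ) = (τ : ℂ) ^ 2 * (E2 τ - 1 / (2 * (π ^ 2 / 6)) * (2 * π * I / τ)) := by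
    rw [← h, zpow_neg, zpow_ofNat]; field_simp
  rw [h']
  field_simp

/-- `E₂|₂S = E₂ − 6i/(πτ)` pointwise: `(E₂|₂S)(τ) = E₂(τ) − 6i/(πτ)`. [cite: CohnEtAl2019, §2.1.1 (2.4)] -/
theorem E2_slash_S_apply (τ : ℍ) :
    (E2 ∣[(2 : ℤ)] ModularGroup.S) τ = E2 τ - 6 * I / (π * (τ : ℂ)) := by
  rw [SL_slash_apply, ModularGroup.denom_S, E2_S_smul, zpow_neg, zpow_ofNat]
  have hτ : (τ : ℂ) ≠ 0 := τ.ne_zero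
  have hπ : (π : ℂ) ≠ 0 := ofReal_ne_zero.2 Real.pi_ne_zero
  field_simp

/-- `E₂|₂T = E₂`. [cite: CohnEtAl2019, §2.1.1 (2.4)] -/
theorem E2_slash_T : E2 ∣[(2 : ℤ)] ModularGroup.T = E2 := by
  have h := E2_slash_action ModularGroup.T
  rwa [D2_T, smul_zero, sub_zero] at h

/-! ## Pointwise form of the actions of `T` and `S` -/

/-- `(g|ₖS)(τ) = g(−1/τ) τ^{−k}`. [folklore] -/
theorem slash_S_apply' (g : ℍ → ℂ) (k : ℤ) (τ : ℍ) :
    (g ∣[k] ModularGroup.S) τ = g (ModularGroup.S • τ) * (τ : ℂ) ^ (-k) := by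
  rw [SL_slash_apply, ModularGroup.denom_S]

/-- The coordinate of `S • τ` is `−1/τ`. [folklore] -/
theorem coe_S_smul (τ : ℍ) : ((ModularGroup.S • τ : ℍ) : ℂ) = -(τ : ℂ)⁻¹ := by
  rw [modular_S_smul, UpperHalfPlane.coe_mk, inv_neg]

/-! ## The functions `φ₋₂`, `φ₀`, `φ₂` -/

/-- **`φ₋₂(τ) = τ`** (CKMRV Prop. 4.2). [cite: CohnEtAl2019, §4.2 Proposition 4.2] -/
def phiNeg2 (τ : ℍ) : ℂ := τ

/-- **`φ₀(τ) = τE₂(τ) − 3i/π`** (CKMRV Prop. 4.2). [cite: CohnEtAl2019, §4.2 Proposition 4.2] -/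
def phi0 (τ : ℍ) : ℂ := (τ : ℂ) * E2 τ - 3 * I / π

/-- **`φ₂(τ) = τE₂(τ)² − (6i/π)E₂(τ)`** (CKMRV Prop. 4.2). [cite: CohnEtAl2019, §4.2 Proposition 4.2] -/
def phi2 (τ : ℍ) : ℂ := (τ : ℂ) * E2 τ ^ 2 - 6 * I / π * E2 τ

/-- `φ₋₂(τ + 1) = φ₋₂(τ) + 1`. [folklore] -/
theorem phiNeg2_vadd_one (τ : ℍ) : phiNeg2 ((1 : ℝ) +ᵥ τ) = phiNeg2 τ + 1 := by
  simp [phiNeg2, coe_vadd, add_comm]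

/-- `φ₀(τ + 1) = φ₀(τ) + E₂(τ)`. [folklore] -/
theorem phi0_vadd_one (τ : ℍ) : phi0 ((1 : ℝ) +ᵥ τ) = phi0 τ + E2 τ := by
  rw [phi0, phi0, E2_vadd_one, coe_vadd, ofReal_one]; ring

/-- `φ₂(τ + 1) = φ₂(τ) + E₂(τ)²`. [folklore] -/
theorem phi2_vadd_one (τ : ℍ) : phi2 ((1 : ℝ) +ᵥ τ) = phi2 τ + E2 τ ^ 2 := by
  rw [phi2, phi2, E2_vadd_one, coe_vadd, ofReal_one]; ring

/-- `φ₋₂(−1/τ) = −τ⁻² φ₋₂(τ)` (`φ₋₂|₋₂S = −φ₋₂`). [folklore] -/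
theorem phiNeg2_S_smul (τ : ℍ) : phiNeg2 (ModularGroup.S • τ) = -((τ : ℂ) ^ 2)⁻¹ * phiNeg2 τ := by
  have hτ : (τ : ℂ) ≠ 0 := τ.ne_zero
  rw [phiNeg2, phiNeg2, coe_S_smul]
  field_simp

/-- `φ₀(−1/τ) = −φ₀(τ)` (`φ₀|₀S = −φ₀`). [folklore] -/
theorem phi0_S_smul (τ : ℍ) : phi0 (ModularGroup.S • τ) = -phi0 τ := by
  have hτ : (τ : ℂ) ≠ 0 := τ.ne_zero
  have hπ : (π : ℂ) ≠ 0 := ofReal_ne_zero.2 Real.pi_ne_zero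
  rw [phi0, phi0, E2_S_smul, coe_S_smul]
  field_simp
  ring

/-- `φ₂(−1/τ) = −τ² φ₂(τ)` (`φ₂|₂S = −φ₂`). [folklore] -/
theorem phi2_S_smul (τ : ℍ) : phi2 (ModularGroup.S • τ) = -(τ : ℂ) ^ 2 * phi2 τ := by
  have hτ : (τ : ℂ) ≠ 0 := τ.ne_zero
  have hπ : (π : ℂ) ≠ 0 := ofReal_ne_zero.2 Real.pi_ne_zero
  rw [phi2, phi2, E2_S_smul, coe_S_smul]
  field_simp
  ring_nf

/-- `φ₋₂, φ₀, φ₂ ∈ 𝓟` (polynomials in `τ` and `E₂`). [cite: CohnEtAl2019, §4.2] -/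
theorem isClassP_phiNeg2 : IsClassP phiNeg2 := isClassP_coe

/-- `φ₀ ∈ 𝓟`. [cite: CohnEtAl2019, §4.2] -/
theorem isClassP_phi0 : IsClassP phi0 := by
  have h : phi0 = (fun τ : ℍ => (τ : ℂ)) * E2 - fun _ => 3 * I / π := by
    funext τ; simp [phi0]
  rw [h]
  exact (isClassP_coe.mul isClassP_E2).sub (isClassP_const _)

/-- `φ₂ ∈ 𝓟`. [cite: CohnEtAl2019, §4.2] -/
theorem isClassP_phi2 : IsClassP phi2 := by
  have h : phi2 = (fun τ : ℍ => (τ : ℂ)) * E2 ^ 2 - (6 * I / π) • E2 := by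
    funext τ; simp [phi2, smul_eq_mul]
  rw [h]
  exact (isClassP_coe.mul (isClassP_E2.pow 2)).sub (isClassP_E2.smul _)

/-! ## The easy inclusion of Proposition 4.2: `φⱼ · M_{k−j} ⊆ Ann_k(𝓘₊, 𝓟)` -/

/-- **The system (4.5)**: `g|ₖ(T − I)² = 0` and `g|ₖ(S + I) = 0`, i.e. `g` is annihilated by the
right ideal `𝓘₊ = (S + I)·R + (T − I)²·R` of `R = ℂ[PSL₂(ℤ)]` under the weight-`k` action
(membership in `𝓟` is kept separate). [cite: CohnEtAl2019, §4.2 (4.5)] -/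
structure IsAnnPlus (k : ℤ) (g : ℍ → ℂ) : Prop where
  T_sq : (g ∣[k] ModularGroup.T) ∣[k] ModularGroup.T - (2 : ℂ) • g ∣[k] ModularGroup.T + g = 0
  S_add : g ∣[k] ModularGroup.S + g = 0

/-- If `g|ₖT = g + h` with `h|ₖT = h`, then `g|ₖ(T − I)² = 0`. [folklore] -/
theorem T_sq_of_slash_T_eq_add {k : ℤ} {g h : ℍ → ℂ} (hg : g ∣[k] ModularGroup.T = g + h)
    (hh : h ∣[k] ModularGroup.T = h) :
    (g ∣[k] ModularGroup.T) ∣[k] ModularGroup.T - (2 : ℂ) • g ∣[k] ModularGroup.T + g = 0 := by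
  rw [hg, SlashAction.add_slash, hg, hh, two_smul]
  abel

/-- **`φ₋₂ f ∈ Ann_k(𝓘₊)`** for `f` invariant of weight `k + 2` under `T` and `S` (e.g.
`f ∈ M_{k+2}(SL₂(ℤ))`): `(τf)|ₖT = τf + f`, `(τf)|ₖS = −τf`. [cite: CohnEtAl2019, §4.2 Proposition 4.2] -/
theorem phiNeg2_mul_isAnnPlus {k : ℤ} {f : ℍ → ℂ} (hT : f ∣[k + 2] ModularGroup.T = f)
    (hS : f ∣[k + 2] ModularGroup.S = f) : IsAnnPlus k (phiNeg2 * f) := by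
  have hfT : ∀ τ : ℍ, f ((1 : ℝ) +ᵥ τ) = f τ := fun τ => by
    rw [← slash_T_apply f (k + 2) τ, hT]
  have hfS : ∀ τ : ℍ, f (ModularGroup.S • τ) = f τ * (τ : ℂ) ^ (k + 2) := fun τ => by
    have h := congrFun hS τ
    rw [slash_S_apply'] at h
    rw [← h, mul_assoc, ← zpow_add₀ τ.ne_zero, neg_add_cancel, zpow_zero, mul_one]
  have hgT : (phiNeg2 * f) ∣[k] ModularGroup.T = phiNeg2 * f + f := by
    funext τ
    rw [slash_T_apply, Pi.mul_apply, Pi.add_apply, Pi.mul_apply, phiNeg2_vadd_one, hfT]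
    ring
  have hhT : f ∣[k] ModularGroup.T = f := by
    funext τ; rw [slash_T_apply, hfT]
  refine ⟨T_sq_of_slash_T_eq_add hgT hhT, ?_⟩
  funext τ
  rw [Pi.add_apply, slash_S_apply', Pi.mul_apply, Pi.mul_apply, phiNeg2_S_smul, hfS,
    Pi.zero_apply]
  have hτ : (τ : ℂ) ≠ 0 := τ.ne_zero
  rw [zpow_add₀ hτ, zpow_neg, zpow_ofNat]
  field_simp
  ring

/-- **`φ₀ f ∈ Ann_k(𝓘₊)`** for `f` invariant of weight `k` under `T` and `S` (e.g.
`f ∈ M_k(SL₂(ℤ))`): `(φ₀f)|ₖT = φ₀f + E₂f`, `(φ₀f)|ₖS = −φ₀f`. [cite: CohnEtAl2019, §4.2 Proposition 4.2] -/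
theorem phi0_mul_isAnnPlus {k : ℤ} {f : ℍ → ℂ} (hT : f ∣[k] ModularGroup.T = f)
    (hS : f ∣[k] ModularGroup.S = f) : IsAnnPlus k (phi0 * f) := by
  have hfT : ∀ τ : ℍ, f ((1 : ℝ) +ᵥ τ) = f τ := fun τ => by
    rw [← slash_T_apply f k τ, hT]
  have hfS : ∀ τ : ℍ, f (ModularGroup.S • τ) * (τ : ℂ) ^ (-k) = f τ := fun τ => by
    rw [← slash_S_apply' f k τ, hS]
  have hgT : (phi0 * f) ∣[k] ModularGroup.T = phi0 * f + E2 * f := by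
    funext τ
    rw [slash_T_apply, Pi.mul_apply, Pi.add_apply, Pi.mul_apply, Pi.mul_apply, phi0_vadd_one,
      hfT]
    ring
  have hhT : (E2 * f) ∣[k] ModularGroup.T = E2 * f := by
    funext τ; rw [slash_T_apply, Pi.mul_apply, Pi.mul_apply, E2_vadd_one, hfT]
  refine ⟨T_sq_of_slash_T_eq_add hgT hhT, ?_⟩
  funext τ
  rw [Pi.add_apply, slash_S_apply', Pi.mul_apply, Pi.mul_apply, phi0_S_smul, mul_assoc, hfS,
    Pi.zero_apply]
  ring

/-- **`φ₂ f ∈ Ann_k(𝓘₊)`** for `f` invariant of weight `k − 2` under `T` and `S` (e.g.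
`f ∈ M_{k−2}(SL₂(ℤ))`): `(φ₂f)|ₖT = φ₂f + E₂²f`, `(φ₂f)|ₖS = −φ₂f`. [cite: CohnEtAl2019, §4.2 Proposition 4.2] -/
theorem phi2_mul_isAnnPlus {k : ℤ} {f : ℍ → ℂ} (hT : f ∣[k - 2] ModularGroup.T = f)
    (hS : f ∣[k - 2] ModularGroup.S = f) : IsAnnPlus k (phi2 * f) := by
  have hfT : ∀ τ : ℍ, f ((1 : ℝ) +ᵥ τ) = f τ := fun τ => by
    rw [← slash_T_apply f (k - 2) τ, hT]
  have hfS : ∀ τ : ℍ, f (ModularGroup.S • τ) = f τ * (τ : ℂ) ^ (k - 2) := fun τ => by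
    have h := congrFun hS τ
    rw [slash_S_apply'] at h
    rw [← h, mul_assoc, ← zpow_add₀ τ.ne_zero, neg_add_cancel, zpow_zero, mul_one]
  have hgT : (phi2 * f) ∣[k] ModularGroup.T = phi2 * f + E2 ^ 2 * f := by
    funext τ
    rw [slash_T_apply, Pi.mul_apply, Pi.add_apply, Pi.mul_apply, Pi.mul_apply, Pi.pow_apply,
      phi2_vadd_one, hfT]
    ring
  have hhT : (E2 ^ 2 * f) ∣[k] ModularGroup.T = E2 ^ 2 * f := by
    funext τ; rw [slash_T_apply, Pi.mul_apply, Pi.mul_apply, Pi.pow_apply, Pi.pow_apply,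
      E2_vadd_one, hfT]
  refine ⟨T_sq_of_slash_T_eq_add hgT hhT, ?_⟩
  funext τ
  rw [Pi.add_apply, slash_S_apply', Pi.mul_apply, Pi.mul_apply, phi2_S_smul, hfS, Pi.zero_apply]
  have hτ : (τ : ℂ) ≠ 0 := τ.ne_zero
  rw [zpow_sub₀ hτ, zpow_neg, zpow_ofNat]
  field_simp
  ring

/-- The three families for a level-one modular form `f` (bundled version): `φ₋₂ f`, with `f` of
weight `k + 2`. [cite: CohnEtAl2019, §4.2 Proposition 4.2] -/
theorem phiNeg2_mul_isAnnPlus_of_modularForm {k : ℤ} (f : ModularForm 𝒮ℒ (k + 2)) :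
    IsAnnPlus k (phiNeg2 * ⇑f) :=
  phiNeg2_mul_isAnnPlus (f.slash_action_eq' _ ⟨ModularGroup.T, rfl⟩)
    (f.slash_action_eq' _ ⟨ModularGroup.S, rfl⟩)

/-- `φ₀ f` for `f ∈ M_k(SL₂(ℤ))`. [cite: CohnEtAl2019, §4.2 Proposition 4.2] -/
theorem phi0_mul_isAnnPlus_of_modularForm {k : ℤ} (f : ModularForm 𝒮ℒ k) :
    IsAnnPlus k (phi0 * ⇑f) :=
  phi0_mul_isAnnPlus (f.slash_action_eq' _ ⟨ModularGroup.T, rfl⟩)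
    (f.slash_action_eq' _ ⟨ModularGroup.S, rfl⟩)

/-- `φ₂ f` for `f ∈ M_{k−2}(SL₂(ℤ))`. [cite: CohnEtAl2019, §4.2 Proposition 4.2] -/
theorem phi2_mul_isAnnPlus_of_modularForm {k : ℤ} (f : ModularForm 𝒮ℒ (k - 2)) :
    IsAnnPlus k (phi2 * ⇑f) :=
  phi2_mul_isAnnPlus (f.slash_action_eq' _ ⟨ModularGroup.T, rfl⟩)
    (f.slash_action_eq' _ ⟨ModularGroup.S, rfl⟩)

/-- `Ann_k(𝓘₊)` is a linear space: closed under addition. [folklore] -/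
theorem IsAnnPlus.add {k : ℤ} {g h : ℍ → ℂ} (hg : IsAnnPlus k g) (hh : IsAnnPlus k h) :
    IsAnnPlus k (g + h) := by
  refine ⟨?_, ?_⟩
  · have := congrArg₂ (· + ·) hg.T_sq hh.T_sq
    simp only [add_zero] at this
    rw [← this, SlashAction.add_slash, SlashAction.add_slash, smul_add]
    abel
  · have := congrArg₂ (· + ·) hg.S_add hh.S_add
    simp only [add_zero] at this
    rw [← this, SlashAction.add_slash]
    abel

/-- `Ann_k(𝓘₊)` is closed under scalars. [folklore] -/
theorem IsAnnPlus.smul {k : ℤ} {g : ℍ → ℂ} (hg : IsAnnPlus k g) (c : ℂ) : IsAnnPlus k (c • g) := by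
  refine ⟨?_, ?_⟩
  · have := congrArg (c • ·) hg.T_sq
    simp only [smul_zero] at this
    rw [← this, SL_smul_slash, SL_smul_slash, smul_add, smul_sub, smul_comm c (2 : ℂ)]
  · have := congrArg (c • ·) hg.S_add
    simp only [smul_zero] at this
    rw [← this, SL_smul_slash, smul_add]

end Literature.NumberTheory.ModularForms
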